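import Literature.Analysis.FluidPDE.NSGaldiEnergyEquality
import Literature.Analysis.FluidPDE.NSGaldiEnergyClass
import Literature.Analysis.FluidPDE.NSGaldiVorticityL2
import HarnessLib

/-!
# Discharge of the class assertion of Galdi's theorem (`galdi_lerayHopf_class`)

Analysis/FluidPDE proofs file for `Literature/Analysis/FluidPDE/NSGaldiEnergyEquality`: it
**discharges the named fact** `Literature.Analysis.FluidPDE.galdi_lerayHopf_class` — Galdi 2019,
Proc. AMS 147, Thm. 1.1, the class assertion "`v` is in the class (1.2)", i.e. a distributional
(pressure-free, divergence-free-tested) solution `u` of the unforced Navier–Stokes system on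
`ℝ³ × (0,T)` with datum `u₀ ∈ L²_σ(ℝ³)` which lies in `L⁴(0,T; L⁴(ℝ³))` belongs to
`L^∞(0,T; L²) ∩ L²(0,T; H¹)` — as `galdi_lerayHopf_class_holds`.

## Proof (the tree's whole-space duality proof; Galdi's own argument is by duality with the
## mollified-drift adjoint Oseen problem, Lemma 2.1, (2.10)–(2.15), Lemma A.1)

The two halves are the theorems

* `IsWeakNSSolutionOn.memLqLp_top_two_of_L4` (`FluidPDE/NSGaldiEnergyClass`): `u ∈ L^∞(0,T; L²)`,
  by the `L¹ₜL²ₓ` duality bound with finite sums of curl-type test fields against the backward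
  caloric Duhamel integral (`NSGaldiDualityIdentity`, `NSGaldiDualityBounds`), time slicing, and
  `L²` by duality with curls (`DivCurlAnnihilator`, `L2DualityTools`);
* `IsWeakNSSolutionOn.exists_weakGradient_of_L4` (`FluidPDE/NSGaldiVorticityL2`, dimension `3`):
  square-integrable weak gradients of almost every slice, by the `L²(Q_T)` duality bound (heat
  maximal regularity), Riesz representation of the weak vorticity, slicing, and the `div`–`curl`
  passage from `L²` vorticity to `L²` gradient (`NSGaldiDivCurlWeak`, `DivCurlL2`,
  `MollifiedField`);

specialised to `E = ℝ³ = EuclideanSpace ℝ (Fin 3)` (`finrank = 3`), the mixed class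
`L⁴(0,T; L⁴)` being converted to `L⁴` of the slab by the accepted
`eLpNorm_uncurry_lt_top_of_memLqLp_four` (`NSGaldiExtendedTest`). The weak divergence-freeness
of the datum, part of the hypotheses of the fact, is not needed.

## References

* G. P. Galdi, *On the energy equality for distributional solutions to Navier–Stokes equations*,
  Proc. Amer. Math. Soc. 147 (2019), 785–792 (arXiv:1710.05725), Thm. 1.1. Bib key `Galdi2018`.
-/

noncomputable section

open MeasureTheory TopologicalSpace Set Function Filter
open scoped InnerProductSpace RealInnerProductSpace ENNReal NNReal

namespace Literature.Analysis.FluidPDE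

/-- **Discharge of `galdi_lerayHopf_class`** (Galdi 2019, Proc. AMS 147, Thm. 1.1, class
assertion): a distributional solution `u ∈ L⁴(0,T; L⁴(ℝ³))` of the unforced Navier–Stokes
system with datum `u₀ ∈ L²_σ(ℝ³)` lies in `L^∞(0,T; L²)` and has, for a.e. `t ∈ (0,T)`, a
weak gradient `G(t)` of the slice `u(t)` with `∫₀ᵀ ∫ |G|² < ∞`. Assembled from
`IsWeakNSSolutionOn.memLqLp_top_two_of_L4` and `IsWeakNSSolutionOn.exists_weakGradient_of_L4`
at `E = ℝ³`. [cite: Galdi2018, Thm 1.1] -/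
theorem galdi_lerayHopf_class_holds : galdi_lerayHopf_class := by
  intro ν T hν hT u₀ u hu₀ _hdiv₀ hw h₄
  have hv4 := eLpNorm_uncurry_lt_top_of_memLqLp_four
    (aestronglyMeasurable_uncurry_prod_of_restrict hw.1) h₄
  exact ⟨(hw.memLqLp_top_two_of_L4 hν hT hu₀ h₄).1,
    hw.exists_weakGradient_of_L4 finrank_euclideanSpace_fin hν hT hu₀ hv4⟩

end Literature.Analysis.FluidPDE
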